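import Mathlib
import Summits.ValiantsHypothesis.ValiantsHypothesis.Theorems.DivisionGapPerMultiplesHardDeepPureCountLevels
import Summits.ValiantsHypothesis.ValiantsHypothesis.Theorems.DivisionGapPerMultiplesHardStubPureLevelProduct
import Summits.ValiantsHypothesis.ValiantsHypothesis.Theorems.DivisionGapPerMultiplesHardStubLevelEntropy
import Summits.ValiantsHypothesis.ValiantsHypothesis.Theorems.DivisionGapPerMultiplesHardStubTypedDecompositionLL
import Summits.ValiantsHypothesis.ValiantsHypothesis.Theorems.DivisionGapPerMultiplesHardStubSharpChoose

/-!
# `DivisionGap.PerMultiplesHard` (stmt-ValiantsHypothesis-5068), line `uncharged-face-walk`: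
the DEEP PURE COUNT (stub `deepPureCount`; lead c3)

For every depth `D`, every board `m ≥ 3^{(D+2)²}`, every `N ≥ 1` and every `g ∈ ℝ≥0[x_ij]` on the
`m × m` board all of whose exponents have ALL row and column margins `N`, with `L = L⁺(g)` (the
tree's monotone fan-in-two `complexity`) and `E_D = 3^{(D+1)²}`:

  `#pure(g) · 3^{D m} ≤ (L+1)^{E_D} · m! · (m+1)^{E_D} · 2^{D(m − ⌊m/3⌋) + 3^{(D+2)²}}`,

i.e. `#pure(g) ≲ L^{E_D} · m! · 2^{−0.918·D·m}` — the constant-margin analogue of the landed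
`deepCount` (`N = 1`).  LEVEL-SET RECURSION, induction on `D`: decompose `g = Σ_{t<s} a_t b_t`
two-sidedly (`stub_typedDecompositionLL`, window 3); a pure exponent `N·P_π` of `a_t b_t` splits as
`A_π + B_π`, so `π` respects the level sets of the margins `ρ` of `a_t`; the pure exponents of
`a_t b_t` inject into the product of the level slices (`PureLevelProduct`, landed); the slices are
bounded in part 1 (`a_level_bound`, `levelBoundB`); the product over the a-levels is
`prod_levels_le` — the small levels' missing `3^{D S}` is exactly `LevelEntropy.stub_levelEntropy`
with threshold `3^{D+2}` and there are at most `3^{D+2}` big levels —; `pure_term_le` assembles one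
term with the entropy-sharp binomial `k!(m−k)!·3^m ≤ m!(m+1)2^{m−⌊m/3⌋}` (`stub_sharpChoose`);
`deepPureCount` sums the `s ≤ L` terms.  Consequence (with the landed host-descent lever
`HostDescent.stub_hostDescent`): the padded cofactors `h_pad`, `h_univ = (Σ_{X α-regular} x^X)·g_𝒯`
of the crux notes die for every constant density `α` (the descendant at host `X₀` has
`#pure = #PM(X₀) ≈ m!·α^m`). [cite: JerrumSnir1982, §3–§4.3]
-/

noncomputable section

open MvPolynomial Literature.Computability.AlgebraicComplexity
open scoped NNReal BigOperators
open Literature.Barriers.ValiantsHypothesis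
open Summit.ValiantsHypothesis.ValiantsHypothesis.Theorems.DivisionGap.PerMultiplesHard

namespace Summit.ValiantsHypothesis.ValiantsHypothesis.Theorems.DivisionGap.PerMultiplesHard.DeepPureCount

/-! ### The product over the levels: entropy pays the small levels -/

/-- **Product bound over the levels `v ∈ [1, N]`.**  If every level obeys the big/small bound of
`a_level_bound` and the level sizes sum to `k > 0`, then
`(Π_v #X v) · 3^{D k} ≤ (L+1)^{E·M} (m+1)^{E·M} 2^{D(k − ⌊k/3⌋) + D·M + C·M} · k!` with `M = 3^{D+2}`:
the small levels' missing factor `3^{D·S}` is exactly `stub_levelEntropy` with threshold `M`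
(`M^S = 9^S · 3^{DS}`), and there are at most `M` big levels. [folklore] -/
theorem prod_levels_le {D m L k N : ℕ} (kv : ℕ → ℕ) (X : ℕ → Finset ((Fin m × Fin m) →₀ ℕ))
    (hsum : ∑ v ∈ Finset.Icc 1 N, kv v = k) (hkpos : 0 < k)
    (hX : ∀ v ∈ Finset.Icc 1 N, (X v).card * 3 ^ (D * kv v) ≤
      (if 3 ^ (D + 2) * kv v < k then (kv v).factorial * 3 ^ (D * kv v)
        else (L + 1) ^ (3 ^ ((D + 1) ^ 2)) * ((kv v).factorial *
          ((m + 1) ^ (3 ^ ((D + 1) ^ 2)) * 2 ^ (D * (kv v - kv v / 3) + 3 ^ ((D + 2) ^ 2)))))) :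
    (∏ v ∈ Finset.Icc 1 N, (X v).card) * 3 ^ (D * k) ≤
      (L + 1) ^ (3 ^ ((D + 1) ^ 2) * 3 ^ (D + 2)) * ((m + 1) ^ (3 ^ ((D + 1) ^ 2) * 3 ^ (D + 2)) *
        (2 ^ (D * (k - k / 3) + D * 3 ^ (D + 2) + 3 ^ ((D + 2) ^ 2) * 3 ^ (D + 2)) * k.factorial)) := by
  classical
  set I := Finset.Icc 1 N with hI
  set MD := 3 ^ (D + 2) with hMD
  set E := 3 ^ ((D + 1) ^ 2) with hE
  set CC := 3 ^ ((D + 2) ^ 2) with hCC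
  set small := I.filter (fun v => MD * kv v < k) with hsmall
  set big := I.filter (fun v => ¬ MD * kv v < k) with hbig
  set S := ∑ v ∈ small, kv v with hS
  -- (1) termwise
  have h1 : (∏ v ∈ I, (X v).card) * 3 ^ (D * k) = ∏ v ∈ I, ((X v).card * 3 ^ (D * kv v)) := by
    rw [Finset.prod_mul_distrib, Finset.prod_pow_eq_pow_sum, ← Finset.mul_sum, hsum]
  have h2 : ∏ v ∈ I, ((X v).card * 3 ^ (D * kv v)) ≤
      ∏ v ∈ I, (if MD * kv v < k then (kv v).factorial * 3 ^ (D * kv v)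
        else (L + 1) ^ E * ((kv v).factorial * ((m + 1) ^ E * 2 ^ (D * (kv v - kv v / 3) + CC)))) :=
    Finset.prod_le_prod (fun _ _ => Nat.zero_le _) hX
  -- (2) split the product into small and big levels
  have h3 : ∏ v ∈ I, (if MD * kv v < k then (kv v).factorial * 3 ^ (D * kv v)
        else (L + 1) ^ E * ((kv v).factorial * ((m + 1) ^ E * 2 ^ (D * (kv v - kv v / 3) + CC)))) =
      (∏ v ∈ small, ((kv v).factorial * 3 ^ (D * kv v))) *
        ∏ v ∈ big, ((L + 1) ^ E * ((kv v).factorial * ((m + 1) ^ E * 2 ^ (D * (kv v - kv v / 3) + CC)))) :=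
    Finset.prod_ite _ _
  have hsmallprod : ∏ v ∈ small, ((kv v).factorial * 3 ^ (D * kv v)) =
      (∏ v ∈ small, (kv v).factorial) * 3 ^ (D * S) := by
    rw [Finset.prod_mul_distrib, Finset.prod_pow_eq_pow_sum, ← Finset.mul_sum]
  have hbigprod : ∏ v ∈ big, ((L + 1) ^ E * ((kv v).factorial *
        ((m + 1) ^ E * 2 ^ (D * (kv v - kv v / 3) + CC)))) =
      (L + 1) ^ (E * big.card) * ((∏ v ∈ big, (kv v).factorial) *
        ((m + 1) ^ (E * big.card) * 2 ^ (∑ v ∈ big, (D * (kv v - kv v / 3) + CC)))) := by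
    rw [Finset.prod_mul_distrib, Finset.prod_const, Finset.prod_mul_distrib, Finset.prod_mul_distrib,
      Finset.prod_const, Finset.prod_pow_eq_pow_sum, pow_mul, pow_mul]
  -- (3) entropy: `3^{D S} · Π_I kv! ≤ k!`
  have hent : 3 ^ (D * S) * ∏ v ∈ I, (kv v).factorial ≤ k.factorial := by
    have h := LevelEntropy.stub_levelEntropy MD I kv
    rw [hsum] at h
    -- `h : MD^S * Π kv! ≤ 9^S * k!`
    have hMDS : MD ^ S = 9 ^ S * 3 ^ (D * S) := by
      rw [hMD, pow_add, mul_pow, ← pow_mul, mul_comm]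
      norm_num
    rw [hMDS, mul_assoc] at h
    exact Nat.le_of_mul_le_mul_left h (Nat.pow_pos (by norm_num))
  have hprodsplit : ∏ v ∈ I, (kv v).factorial =
      (∏ v ∈ small, (kv v).factorial) * ∏ v ∈ big, (kv v).factorial :=
    (Finset.prod_filter_mul_prod_filter_not I (fun v => MD * kv v < k) _).symm
  -- (4) at most `MD` big levels
  have hbigcard : big.card ≤ MD := by
    have hle : big.card * k ≤ MD * k := by
      calc big.card * k = big.card • k := (smul_eq_mul _ _).symm
        _ ≤ ∑ v ∈ big, MD * kv v :=
            Finset.card_nsmul_le_sum big (fun v => MD * kv v) k fun v hv => by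
              rw [hbig, Finset.mem_filter] at hv
              exact not_lt.1 hv.2
        _ = MD * ∑ v ∈ big, kv v := (Finset.mul_sum _ _ _).symm
        _ ≤ MD * k := by
            refine Nat.mul_le_mul_left MD ?_
            rw [← hsum]
            exact Finset.sum_le_sum_of_subset_of_nonneg (Finset.filter_subset _ _)
              fun _ _ _ => Nat.zero_le _
    exact Nat.le_of_mul_le_mul_right hle hkpos
  -- (5) the 2-exponent of the big levels
  have hexp : ∑ v ∈ big, (D * (kv v - kv v / 3) + CC) ≤ D * (k - k / 3) + D * MD + CC * MD := by
    rw [Finset.sum_add_distrib, Finset.sum_const, smul_eq_mul, ← Finset.mul_sum]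
    have hsb : ∑ v ∈ big, kv v ≤ k := by
      rw [← hsum]
      exact Finset.sum_le_sum_of_subset_of_nonneg (Finset.filter_subset _ _) fun _ _ _ => Nat.zero_le _
    have h5 := sum_sub_div_three_le big kv
    have h6 : (∑ v ∈ big, kv v) - (∑ v ∈ big, kv v) / 3 ≤ k - k / 3 := sub_div_three_mono hsb
    calc D * ∑ v ∈ big, (kv v - kv v / 3) + big.card * CC
        ≤ D * (k - k / 3 + MD) + MD * CC :=
          Nat.add_le_add (Nat.mul_le_mul_left D (by omega)) (Nat.mul_le_mul_right CC hbigcard)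
      _ = D * (k - k / 3) + D * MD + CC * MD := by ring
  -- (6) assemble
  have hL1 : 1 ≤ L + 1 := Nat.succ_le_succ (Nat.zero_le _)
  have hm1 : 1 ≤ m + 1 := Nat.succ_le_succ (Nat.zero_le _)
  rw [h1]
  refine h2.trans ?_
  rw [h3, hsmallprod, hbigprod]
  calc (∏ v ∈ small, (kv v).factorial) * 3 ^ (D * S) *
        ((L + 1) ^ (E * big.card) * ((∏ v ∈ big, (kv v).factorial) *
          ((m + 1) ^ (E * big.card) * 2 ^ (∑ v ∈ big, (D * (kv v - kv v / 3) + CC)))))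
      = (L + 1) ^ (E * big.card) * ((m + 1) ^ (E * big.card) *
          (2 ^ (∑ v ∈ big, (D * (kv v - kv v / 3) + CC)) *
            (3 ^ (D * S) * ((∏ v ∈ small, (kv v).factorial) * ∏ v ∈ big, (kv v).factorial)))) := by
        ring
    _ ≤ (L + 1) ^ (E * MD) * ((m + 1) ^ (E * MD) *
          (2 ^ (D * (k - k / 3) + D * MD + CC * MD) * k.factorial)) := by
        refine Nat.mul_le_mul (Nat.pow_le_pow_right hL1 (Nat.mul_le_mul_left E hbigcard))
          (Nat.mul_le_mul (Nat.pow_le_pow_right hm1 (Nat.mul_le_mul_left E hbigcard))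
            (Nat.mul_le_mul (Nat.pow_le_pow_right (by norm_num) hexp) ?_))
        rw [← hprodsplit]
        exact hent

/-! ### The per-term bound of the inductive step -/

/-- **Per-term bound of the inductive step** (level-set recursion): for a typed term `a · b` of
the decomposition (margins `N`, `a` typed with row support in the window, `L(a) ≤ L`,
`L(b) ≤ 8L+8`), on a board `m ≥ 3^{(D+3)²}`, assuming the depth-`D` bound on all boards
`≥ 3^{(D+2)²}`:
`#pure(a b) · 3^{(D+1)m} ≤ (L+1)^{E(M+1)} · m! · (m+1)^{E(M+1)+1} · 2^{(D+1)(m−⌊m/3⌋) + 3^{(D+3)²}}`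
(`E = 3^{(D+1)²}`, `M = 3^{D+2}`). [folklore] -/
theorem pure_term_le {D m N L : ℕ}
    (ih : ∀ m', 3 ^ ((D + 2) ^ 2) ≤ m' → ∀ N', 1 ≤ N' → ∀ g' : MvPolynomial (Fin m' × Fin m') ℝ≥0,
      (∀ M ∈ g'.support, (∀ i, ∑ j, M (i, j) = N') ∧ (∀ j, ∑ i, M (i, j) = N')) →
      (g'.support.filter fun M => ∃ σ : Equiv.Perm (Fin m'), ∀ e ∈ M.support, e.1 = σ e.2).card *
          3 ^ (D * m') ≤
        (complexity g' + 1) ^ (3 ^ ((D + 1) ^ 2)) *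
          (m'.factorial * ((m' + 1) ^ (3 ^ ((D + 1) ^ 2)) * 2 ^ (D * (m' - m' / 3) + 3 ^ ((D + 2) ^ 2)))))
    (hm : 3 ^ ((D + 3) ^ 2) ≤ m) (hN : 1 ≤ N)
    {a b : MvPolynomial (Fin m × Fin m) ℝ≥0} (ha0 : a ≠ 0) (hb0 : b ≠ 0)
    (hab : ∀ M ∈ (a * b).support, (∀ i, ∑ j, M (i, j) = N) ∧ (∀ j, ∑ i, M (i, j) = N))
    {ρ γ : Fin m → ℕ}
    (hty : ∀ M ∈ a.support, (∀ i, ∑ j, M (i, j) = ρ i) ∧ (∀ j, ∑ i, M (i, j) = γ j))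
    (hk1 : m < 3 * (Finset.univ.filter fun i => ρ i ≠ 0).card)
    (hk2 : 3 * (Finset.univ.filter fun i => ρ i ≠ 0).card ≤ 2 * m)
    (hLa : complexity a ≤ L) (hLb : complexity b ≤ 8 * L + 8) :
    ((a * b).support.filter fun M => ∃ σ : Equiv.Perm (Fin m), ∀ e ∈ M.support, e.1 = σ e.2).card *
        3 ^ ((D + 1) * m) ≤
      (L + 1) ^ (3 ^ ((D + 1) ^ 2) * (3 ^ (D + 2) + 1)) *
        (m.factorial * ((m + 1) ^ (3 ^ ((D + 1) ^ 2) * (3 ^ (D + 2) + 1) + 1) *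
          2 ^ ((D + 1) * (m - m / 3) + 3 ^ ((D + 3) ^ 2)))) := by
  classical
  set k := (Finset.univ.filter fun i => ρ i ≠ 0).card with hkdef
  set E := 3 ^ ((D + 1) ^ 2) with hE
  set MD := 3 ^ (D + 2) with hMD
  set CC := 3 ^ ((D + 2) ^ 2) with hCC
  -- no pure exponent: nothing to prove
  by_cases hpure : ∃ M ∈ (a * b).support, ∃ σ : Equiv.Perm (Fin m), ∀ e ∈ M.support, e.1 = σ e.2
  swap
  · have h0 : ((a * b).support.filter
        fun M => ∃ σ : Equiv.Perm (Fin m), ∀ e ∈ M.support, e.1 = σ e.2).card = 0 := by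
      rw [Finset.card_eq_zero, Finset.filter_eq_empty_iff]
      exact fun M hM hσ => hpure ⟨M, hM, hσ⟩
    rw [h0, zero_mul]
    exact Nat.zero_le _
  obtain ⟨M₀, hM₀, π₀, hπ₀⟩ := hpure
  obtain ⟨A₀, hA₀, B₀, hB₀, hABM⟩ := Finset.mem_add.1 (support_mul a b hM₀)
  have hA₀le : A₀ ≤ M₀ := hABM ▸ le_self_add
  have hB₀le : B₀ ≤ M₀ := hABM ▸ le_add_self
  have hA₀p : ∀ e ∈ A₀.support, e.1 = π₀ e.2 := pure_of_le hπ₀ hA₀le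
  have hB₀p : ∀ e ∈ B₀.support, e.1 = π₀ e.2 := pure_of_le hπ₀ hB₀le
  -- margins split
  obtain ⟨hρN, -, htyb⟩ := margins_split_gen (R := fun _ => N) (C := fun _ => N) ha0 hb0 hab hty
  -- level data
  have hksum : ∑ v ∈ Finset.Icc 1 N, (Finset.univ.filter fun i => ρ i = v).card = k :=
    sum_card_levels ρ hρN
  have hkpos : 0 < k := by omega
  have hkm : k ≤ m := (Finset.card_filter_le _ _).trans (by simp)
  have hk0 : (Finset.univ.filter fun i => ρ i = 0).card = m - k := by
    have h := Finset.card_filter_add_card_filter_not (s := (Finset.univ : Finset (Fin m)))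
      (fun i => ρ i = 0)
    simp only [Finset.card_univ, Fintype.card_fin] at h
    change (Finset.univ.filter fun i => ρ i = 0).card + k = m at h
    omega
  -- a-side levels
  have hXex : ∀ v ∈ Finset.Icc 1 N, ∃ X : Finset ((Fin m × Fin m) →₀ ℕ),
      (∀ A ∈ a.support, (∃ σ : Equiv.Perm (Fin m), ∀ e ∈ A.support, e.1 = σ e.2) →
        A.filter (fun e => ρ e.1 = v) ∈ X) ∧
      X.card * 3 ^ (D * (Finset.univ.filter fun i => ρ i = v).card) ≤
        (if MD * (Finset.univ.filter fun i => ρ i = v).card < k then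
            ((Finset.univ.filter fun i => ρ i = v).card).factorial *
              3 ^ (D * (Finset.univ.filter fun i => ρ i = v).card)
          else (L + 1) ^ E * (((Finset.univ.filter fun i => ρ i = v).card).factorial *
            ((m + 1) ^ E * 2 ^ (D * ((Finset.univ.filter fun i => ρ i = v).card -
              (Finset.univ.filter fun i => ρ i = v).card / 3) + CC)))) :=
    fun v hv => a_level_bound ih hm hty ⟨A₀, hA₀, π₀, hA₀p⟩ hk1 hLa (Finset.mem_Icc.1 hv).1 rfl
  let X : ℕ → Finset ((Fin m × Fin m) →₀ ℕ) := fun v =>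
    if hv : v ∈ Finset.Icc 1 N then Classical.choose (hXex v hv) else ∅
  have hXmem : ∀ A ∈ a.support, (∃ σ : Equiv.Perm (Fin m), ∀ e ∈ A.support, e.1 = σ e.2) →
      ∀ v ∈ Finset.Icc 1 N, A.filter (fun e => ρ e.1 = v) ∈ X v := by
    intro A hA hAp v hv
    simp only [X, dif_pos hv]
    exact (Classical.choose_spec (hXex v hv)).1 A hA hAp
  have hXbd : ∀ v ∈ Finset.Icc 1 N,
      (X v).card * 3 ^ (D * (Finset.univ.filter fun i => ρ i = v).card) ≤
        (if MD * (Finset.univ.filter fun i => ρ i = v).card < k then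
            ((Finset.univ.filter fun i => ρ i = v).card).factorial *
              3 ^ (D * (Finset.univ.filter fun i => ρ i = v).card)
          else (L + 1) ^ E * (((Finset.univ.filter fun i => ρ i = v).card).factorial *
            ((m + 1) ^ E * 2 ^ (D * ((Finset.univ.filter fun i => ρ i = v).card -
              (Finset.univ.filter fun i => ρ i = v).card / 3) + CC)))) := by
    intro v hv
    simp only [X, dif_pos hv]
    exact (Classical.choose_spec (hXex v hv)).2
  -- b-side level
  obtain ⟨Y, hYmem, hYbd⟩ := levelBoundB (L := L) ih hN hρN htyb ⟨B₀, hB₀, π₀, hB₀p⟩ hk0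
    (threshold_compl hm hk2) (Nat.sub_le m k) hLb
  -- the injection into the product of the levels
  have hprod := PureLevelProduct.stub_pureLevelProduct m N a b ρ γ hty hρN
    (fun M hM i => (hab M hM).1 i) X Y hXmem hYmem
  -- the product over the a-levels
  have hA := prod_levels_le (D := D) (m := m) (L := L) (N := N)
    (fun v => (Finset.univ.filter fun i => ρ i = v).card) X hksum hkpos hXbd
  -- Jerrum–Snir's binomial, entropy-sharp
  have h3m := SharpChoose.stub_sharpChoose m k hk1 hk2
  have hfact : m.choose k * k.factorial * (m - k).factorial = m.factorial :=
    Nat.choose_mul_factorial_mul_factorial hkm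
  -- exponents
  have hDm : (D + 1) * m = D * k + D * (m - k) + m := by
    rw [← Nat.mul_add, Nat.add_sub_of_le hkm]
    ring
  have h16 : (16 : ℕ) ^ E = 2 ^ (4 * E) := by rw [pow_mul]; norm_num
  have hexp2 : D * (k - k / 3) + D * MD + CC * MD + (D * ((m - k) - (m - k) / 3) + CC) + 4 * E +
      (m - m / 3) ≤ (D + 1) * (m - m / 3) + 3 ^ ((D + 3) ^ 2) := by
    have h1 : (k - k / 3) + ((m - k) - (m - k) / 3) ≤ (m - m / 3) + 1 := by omega
    have h2 : D * (k - k / 3) + D * ((m - k) - (m - k) / 3) ≤ D * (m - m / 3) + D := by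
      rw [← Nat.mul_add, ← Nat.mul_succ]
      exact Nat.mul_le_mul_left D h1
    have h3 := const_step D
    rw [← hMD, ← hCC, ← hE] at h3
    nlinarith [h2, h3]
  have hL1 : 1 ≤ L + 1 := Nat.succ_le_succ (Nat.zero_le _)
  have hm1 : 1 ≤ m + 1 := Nat.succ_le_succ (Nat.zero_le _)
  -- assemble
  calc ((a * b).support.filter
          fun M => ∃ σ : Equiv.Perm (Fin m), ∀ e ∈ M.support, e.1 = σ e.2).card * 3 ^ ((D + 1) * m)
      ≤ (∏ v ∈ Finset.Icc 1 N, (X v).card) * Y.card * (3 ^ (D * k) * 3 ^ (D * (m - k)) * 3 ^ m) := by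
        rw [hDm, pow_add, pow_add]
        exact Nat.mul_le_mul_right _ hprod
    _ = ((∏ v ∈ Finset.Icc 1 N, (X v).card) * 3 ^ (D * k)) * (Y.card * 3 ^ (D * (m - k))) * 3 ^ m := by
        ring
    _ ≤ ((L + 1) ^ (E * MD) * ((m + 1) ^ (E * MD) * (2 ^ (D * (k - k / 3) + D * MD + CC * MD) *
          k.factorial))) *
        (16 ^ E * (L + 1) ^ E * ((m - k).factorial * ((m + 1) ^ E *
          2 ^ (D * ((m - k) - (m - k) / 3) + CC)))) *
        ((m + 1) * m.choose k * 2 ^ (m - m / 3)) :=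
        Nat.mul_le_mul (Nat.mul_le_mul hA hYbd) h3m
    _ = (L + 1) ^ (E * MD + E) * ((m.choose k * k.factorial * (m - k).factorial) *
          ((m + 1) ^ (E * MD + E + 1) *
            2 ^ (D * (k - k / 3) + D * MD + CC * MD + (D * ((m - k) - (m - k) / 3) + CC) + 4 * E +
              (m - m / 3)))) := by
        rw [h16]
        ring
    _ ≤ (L + 1) ^ (E * (MD + 1)) * (m.factorial * ((m + 1) ^ (E * (MD + 1) + 1) *
          2 ^ ((D + 1) * (m - m / 3) + 3 ^ ((D + 3) ^ 2)))) := by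
        rw [hfact, Nat.mul_succ]
        exact Nat.mul_le_mul_left _ (Nat.mul_le_mul_left _ (Nat.mul_le_mul_left _
          (Nat.pow_le_pow_right (by norm_num) hexp2)))

/-! ### The theorem -/

/-- **deepPureCount — the deep pure count (level-set recursion; registered stub of line
`uncharged-face-walk`).**  For every depth `D`, every board `m ≥ 3^{(D+2)²}`, every `N ≥ 1` and
every `g` over `ℝ≥0` on the `m`-board all of whose exponents have ALL row and column margins `N`,
with `L = L⁺(g)` and `E_D = 3^{(D+1)²}`:
`#pure(g) · 3^{D m} ≤ (L+1)^{E_D} · m! · (m+1)^{E_D} · 2^{D(m − ⌊m/3⌋) + 3^{(D+2)²}}`,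
where a PURE exponent is one supported inside the graph `{(σ j, j)}` of a permutation (for
`N = 1`, `supp g ⊆ supp per_m`, this is `deepCount` up to constants).  Induction on `D`: `D = 0` is
`#pure ≤ m!`; the step decomposes `g = Σ_t a_t b_t` two-sidedly (`stub_typedDecompositionLL`),
bounds every term by `pure_term_le` (level slices + compression + the injection into the product of
the levels + the induction hypothesis on the big levels + entropy on the small ones + the sharp
binomial) and sums. [cite: JerrumSnir1982, §3–§4.3] -/
theorem deepPureCount : ∀ (D m : ℕ), 3 ^ ((D + 2) ^ 2) ≤ m → ∀ (N : ℕ), 1 ≤ N →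
    ∀ g : MvPolynomial (Fin m × Fin m) ℝ≥0,
      (∀ M ∈ g.support, (∀ i, ∑ j, M (i, j) = N) ∧ (∀ j, ∑ i, M (i, j) = N)) →
      (g.support.filter fun M => ∃ σ : Equiv.Perm (Fin m), ∀ e ∈ M.support, e.1 = σ e.2).card *
          3 ^ (D * m) ≤
        (complexity g + 1) ^ (3 ^ ((D + 1) ^ 2)) *
          (m.factorial * ((m + 1) ^ (3 ^ ((D + 1) ^ 2)) * 2 ^ (D * (m - m / 3) + 3 ^ ((D + 2) ^ 2)))) := by
  intro D
  induction D with
  | zero =>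
    intro m _ N hN g hg
    have hP := card_pure_le_factorial hN g fun M hM j => (hg M hM).2 j
    have h1 : 1 ≤ (complexity g + 1) ^ (3 ^ ((0 + 1) ^ 2)) := Nat.one_le_pow _ _ (Nat.succ_pos _)
    have h2 : 1 ≤ (m + 1) ^ (3 ^ ((0 + 1) ^ 2)) * 2 ^ (0 * (m - m / 3) + 3 ^ ((0 + 2) ^ 2)) :=
      Nat.one_le_iff_ne_zero.2 (Nat.mul_ne_zero (pow_ne_zero _ (Nat.succ_ne_zero _))
        (pow_ne_zero _ (by norm_num)))
    calc (g.support.filter fun M => ∃ σ : Equiv.Perm (Fin m), ∀ e ∈ M.support, e.1 = σ e.2).card *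
          3 ^ (0 * m)
        = (g.support.filter fun M => ∃ σ : Equiv.Perm (Fin m), ∀ e ∈ M.support, e.1 = σ e.2).card := by
          rw [zero_mul, pow_zero, mul_one]
      _ ≤ m.factorial := hP
      _ = 1 * (m.factorial * 1) := by ring
      _ ≤ _ := Nat.mul_le_mul h1 (Nat.mul_le_mul_left _ h2)
  | succ D ih =>
    intro m hm N hN g hg
    classical
    have hm' : 3 ^ ((D + 3) ^ 2) ≤ m := by
      have : D + 1 + 2 = D + 3 := by ring
      rwa [this] at hm
    have hm3 : 3 ≤ m := le_trans (by
      calc (3 : ℕ) = 3 ^ 1 := by norm_num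
        _ ≤ 3 ^ ((D + 3) ^ 2) := Nat.pow_le_pow_right (by norm_num)
            (Nat.one_le_pow _ _ (by omega))) hm'
    obtain ⟨s, hsL, a, b, hgab, ht⟩ := TypedDecompositionLL.stub_typedDecompositionLL m 3 le_rfl
      hm3 g (fun _ => N) (fun _ => N) hg (fun _ => by omega)
    set E := 3 ^ ((D + 1) ^ 2) with hE
    set MD := 3 ^ (D + 2) with hMD
    set BND := m.factorial * ((m + 1) ^ (E * (MD + 1) + 1) *
      2 ^ ((D + 1) * (m - m / 3) + 3 ^ ((D + 3) ^ 2))) with hBND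
    -- every term
    have hterm : ∀ t, ((a t * b t).support.filter
        fun M => ∃ σ : Equiv.Perm (Fin m), ∀ e ∈ M.support, e.1 = σ e.2).card * 3 ^ ((D + 1) * m) ≤
          (complexity g + 1) ^ (E * (MD + 1)) * BND := by
      intro t
      obtain ⟨hLa, hLb, ρ, γ, hty, hk1, hk2⟩ := ht t
      by_cases ha0 : a t = 0
      · simp [ha0]
      by_cases hb0 : b t = 0
      · simp [hb0]
      have hsub : (a t * b t).support ⊆ g.support := by
        refine support_subset_of_eq_add (q := ∑ t' ∈ Finset.univ.erase t, a t' * b t') ?_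
        rw [Finset.add_sum_erase _ (fun t' => a t' * b t') (Finset.mem_univ t)]
        exact hgab
      exact pure_term_le ih hm' hN ha0 hb0 (fun M hM => hg M (hsub hM)) hty hk1 hk2 hLa hLb
    -- sum over the terms
    have hsum : (g.support.filter
        fun M => ∃ σ : Equiv.Perm (Fin m), ∀ e ∈ M.support, e.1 = σ e.2).card ≤
          ∑ t, ((a t * b t).support.filter
            fun M => ∃ σ : Equiv.Perm (Fin m), ∀ e ∈ M.support, e.1 = σ e.2).card := by
      conv_lhs => rw [hgab]
      exact card_pure_sum_le _
    have hexpo := expo_step D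
    rw [← hE, ← hMD] at hexpo
    have hL1 : 1 ≤ complexity g + 1 := Nat.succ_le_succ (Nat.zero_le _)
    have hm1 : 1 ≤ m + 1 := Nat.succ_le_succ (Nat.zero_le _)
    have hD2 : D + 1 + 1 = D + 2 := by ring
    have hD3 : D + 1 + 2 = D + 3 := by ring
    rw [hD2, hD3]
    calc (g.support.filter
            fun M => ∃ σ : Equiv.Perm (Fin m), ∀ e ∈ M.support, e.1 = σ e.2).card * 3 ^ ((D + 1) * m)
        ≤ (∑ t, ((a t * b t).support.filter
            fun M => ∃ σ : Equiv.Perm (Fin m), ∀ e ∈ M.support, e.1 = σ e.2).card) * 3 ^ ((D + 1) * m) :=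
          Nat.mul_le_mul_right _ hsum
      _ = ∑ t, ((a t * b t).support.filter
            fun M => ∃ σ : Equiv.Perm (Fin m), ∀ e ∈ M.support, e.1 = σ e.2).card * 3 ^ ((D + 1) * m) :=
          Finset.sum_mul _ _ _
      _ ≤ ∑ _t : Fin s, (complexity g + 1) ^ (E * (MD + 1)) * BND := Finset.sum_le_sum fun t _ => hterm t
      _ = s * ((complexity g + 1) ^ (E * (MD + 1)) * BND) := by simp
      _ ≤ (complexity g + 1) * ((complexity g + 1) ^ (E * (MD + 1)) * BND) :=
          Nat.mul_le_mul_right _ (by omega)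
      _ = (complexity g + 1) ^ (E * (MD + 1) + 1) * BND := by ring
      _ ≤ (complexity g + 1) ^ (3 ^ ((D + 2) ^ 2)) * (m.factorial * ((m + 1) ^ (3 ^ ((D + 2) ^ 2)) *
            2 ^ ((D + 1) * (m - m / 3) + 3 ^ ((D + 3) ^ 2)))) :=
          Nat.mul_le_mul (Nat.pow_le_pow_right hL1 hexpo) (Nat.mul_le_mul_left _
            (Nat.mul_le_mul_right _ (Nat.pow_le_pow_right hm1 hexpo)))

end Summit.ValiantsHypothesis.ValiantsHypothesis.Theorems.DivisionGap.PerMultiplesHard.DeepPureCount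

end
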